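import Summits.AtomisticToContinuum.Crystallization.Theorems.FrustratedLawDichotomyStrainedPatchHomCurvRegime3
import Mathlib.Analysis.InnerProductSpace.Calculus
import Mathlib.Analysis.SpecialFunctions.Sqrt

/-!
# (I1) part F — the PATH CALCULUS of one label for the G5′ value leaf: first and second derivatives of `s ↦ W₄₅‖y(s)‖` along an ARBITRARY twice
# differentiable path `y : ℝ → E3` (covers the bilinear joint path `(U_c + sΔU)(q_c + sΔξ)` of `…HomValueT2KitL` §12 and the linear block paths of §10)
# (27623 `(H) HomFloor`, hcp half; decomp-a2c hand-1 g41; FINDING-hand-1-g41 §6 (R2), coordinate-free half).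

With `ρ = ‖y‖ ≠ 0`, `β = W′(ρ)/ρ`, `α = (W″(ρ) − W′(ρ)/ρ)/ρ²` (the true coefficients, as in `…HomCurvDispatch2.mem_coeffFI2` / `…HomValueT2SoundA2.mem_coeffT`):
* `hasDerivAt_W_path`: `(W‖y‖)′ = β·⟪y, y′⟫`;
* `hasDerivAt_Wslope_path`: inside the bump or Lennard-Jones regime, `(β⟪y, y′⟫)′ = α⟪y, y′⟫² + β(‖y′‖² + ⟪y, y″⟫)` — the per-label Hessian form
  `α ζζ + β ν` of the kit read along the path (`⟪y, y′⟫ = Σ_p ζ_p δ_p`, `‖y′‖² + ⟪y, y″⟫ = Σ_pq ν_pq δ_p δ_q`).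
No definitions; 0 sorry; standard axioms; no instances / notation / `#eval`.  `--supports stmt-AtomisticToContinuum-27623`.
-/

noncomputable section

namespace Summit.AtomisticToContinuum.Crystallization.Theorems.FrustratedLawDichotomyStrainedPatchHomValueT2Kit

open scoped RealInnerProductSpace
open Summit.AtomisticToContinuum.Crystallization.Theorems.ChargedEnergyGapNegative (E3)
open Summit.AtomisticToContinuum.Crystallization.Theorems.FrustratedLawDichotomySchurCut (effPot w₄₅ ω₄)
open Summit.AtomisticToContinuum.Crystallization.Theorems.FrustratedLawDichotomyStrainedPatchHomTermCalculus (hasDerivAt_effPot45)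
open Summit.AtomisticToContinuum.Crystallization.Theorems.FrustratedLawDichotomyStrainedPatchHomCurvRegime3
  (alphaLJ alphaB alphaTrue_eq_lj alphaTrue_eq_bump hasDerivAt_betaTrue_lj hasDerivAt_betaTrue_bump)

/-- `‖y(s)‖` is differentiable along a differentiable path away from `0`, with derivative `⟪y, y′⟫/‖y‖`. [folklore] -/
theorem hasDerivAt_norm_path {y : ℝ → E3} {y' : E3} {s : ℝ} (hy : HasDerivAt y y' s) (h0 : y s ≠ 0) :
    HasDerivAt (fun t => ‖y t‖) (⟪y s, y'⟫ / ‖y s‖) s := by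
  have hsq : HasDerivAt (fun t => ‖y t‖ ^ 2) (2 * ⟪y s, y'⟫) s := hy.norm_sq
  have hne : ‖y s‖ ^ 2 ≠ 0 := pow_ne_zero 2 (norm_ne_zero_iff.2 h0)
  have hsqrt := hsq.sqrt hne
  have hfun : (fun t => Real.sqrt (‖y t‖ ^ 2)) = fun t => ‖y t‖ := by funext t; exact Real.sqrt_sq (norm_nonneg _)
  rw [hfun] at hsqrt
  refine hsqrt.congr_deriv ?_
  rw [Real.sqrt_sq (norm_nonneg _)]
  field_simp

/-- ★ **FIRST DERIVATIVE along a path**: `(W₄₅‖y‖)′(s) = β(‖y s‖)·⟪y s, y′⟫`, `β(r) = W₄₅′(r)/r`, for `y s ≠ 0`. [folklore: chain rule] -/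
theorem hasDerivAt_W_path {y : ℝ → E3} {y' : E3} {s : ℝ} (hy : HasDerivAt y y' s) (h0 : y s ≠ 0) :
    HasDerivAt (fun t => effPot w₄₅ ω₄ (3 / 400) ‖y t‖) (deriv (effPot w₄₅ ω₄ (3 / 400)) ‖y s‖ / ‖y s‖ * ⟪y s, y'⟫) s := by
  have hρ : ‖y s‖ ≠ 0 := norm_ne_zero_iff.2 h0
  have hW : HasDerivAt (effPot w₄₅ ω₄ (3 / 400)) (deriv (effPot w₄₅ ω₄ (3 / 400)) ‖y s‖) ‖y s‖ :=
    (hasDerivAt_effPot45 hρ).differentiableAt.hasDerivAt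
  have h := hW.comp s (hasDerivAt_norm_path hy h0)
  refine h.congr_deriv ?_
  field_simp

/-- ★★ **SECOND DERIVATIVE along a path (slope of the slope)** inside ONE regime (bump `0 < ρ < 8/5` or Lennard-Jones `8/5 < ρ < 3`): with `y` twice
differentiable at `s` (`HasDerivAt y (y′ s) s` and `HasDerivAt y′ y″ s`),
`(β(‖y‖)⟪y, y′⟫)′(s) = α⟪y s, y′ s⟫² + β(‖y′ s‖² + ⟪y s, y″⟫)`. [folklore: product + chain rule, `β′ = αρ`] -/
theorem hasDerivAt_Wslope_path {y y' : ℝ → E3} {y'' : E3} {s : ℝ} (hy : HasDerivAt y (y' s) s) (hy' : HasDerivAt y' y'' s)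
    (hreg : (0 < ‖y s‖ ∧ ‖y s‖ < 8 / 5) ∨ (8 / 5 < ‖y s‖ ∧ ‖y s‖ < 3)) :
    HasDerivAt (fun t => deriv (effPot w₄₅ ω₄ (3 / 400)) ‖y t‖ / ‖y t‖ * ⟪y t, y' t⟫)
      ((deriv (deriv (effPot w₄₅ ω₄ (3 / 400))) ‖y s‖ - deriv (effPot w₄₅ ω₄ (3 / 400)) ‖y s‖ / ‖y s‖) / ‖y s‖ ^ 2 * ⟪y s, y' s⟫ ^ 2 +
        deriv (effPot w₄₅ ω₄ (3 / 400)) ‖y s‖ / ‖y s‖ * (‖y' s‖ ^ 2 + ⟪y s, y''⟫)) s := by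
  have hpos : 0 < ‖y s‖ := by rcases hreg with h | h <;> linarith [h.1, norm_nonneg (y s)]
  have h0 : y s ≠ 0 := norm_ne_zero_iff.1 hpos.ne'
  -- `β′(ρ) = α(ρ)·ρ` on the regime
  have hβ : HasDerivAt (fun r => deriv (effPot w₄₅ ω₄ (3 / 400)) r / r)
      ((deriv (deriv (effPot w₄₅ ω₄ (3 / 400))) ‖y s‖ - deriv (effPot w₄₅ ω₄ (3 / 400)) ‖y s‖ / ‖y s‖) / ‖y s‖ ^ 2 * ‖y s‖) ‖y s‖ := by
    rcases hreg with h | h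
    · rw [alphaTrue_eq_bump h.1 h.2]; exact hasDerivAt_betaTrue_bump h.1 h.2
    · rw [alphaTrue_eq_lj h.1 h.2]; exact hasDerivAt_betaTrue_lj h.1 h.2
  -- `β(‖y t‖)` along the path
  have hβpath := hβ.comp s (hasDerivAt_norm_path hy h0)
  -- `⟪y t, y′ t⟫` along the path
  have hinner : HasDerivAt (fun t => ⟪y t, y' t⟫) (⟪y s, y''⟫ + ⟪y' s, y' s⟫) s := hy.inner ℝ hy'
  have h := hβpath.mul hinner
  refine h.congr_deriv ?_
  simp only [Function.comp_apply, real_inner_self_eq_norm_sq]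
  field_simp
  ring

end Summit.AtomisticToContinuum.Crystallization.Theorems.FrustratedLawDichotomyStrainedPatchHomValueT2Kit
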